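import Summits.ResolutionOfSingularities.ResolutionOfSingularities.Theorems.EquisingularLiftEquisingularLiftCubicSurfaceSingularPointsAlgebra
import Literature.AlgebraicGeometry.ProjectiveSpace.LinearChangeOfCoordinates
import Literature.Algebra.Polynomial.JacobianCriterion
import HarnessLib

/-!
# [OURS] SINGULAR POINTS OF CUBIC SURFACES — transport of the vertex computations along a linear change of coordinates `x ↦ Bx`
# (cruxes `EquisingularLiftNatThree` stmt-…-20148, `EquisingularLiftNat` stmt-…-20038, `EquisingularLift` stmt-…-15660)

[OURS · leafhand-res-equisingularlift-8 g0, 2026-08-31; cell `pub/decomp-res`] AI-produced, weaker than expert review; NOT a statement of any manuscript;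
nothing here proves resolution of singularities in positive characteristic.  DEF-FREE helper; no `sorry`; standard axioms; ZERO named hypotheses.

Companion of ✓ `…CubicSurfaceSingularPointsAlgebra` (`CubicNodes.mem_sq_of_singular_collinear` / `X_dvd_of_singular_coplanar` / `eq_zero_of_singular_five`):
the singular vectors of `F` are carried to the vertices of `F ∘ B = aeval B.toMvPolynomial F` (✓ `Literature…LinearChangeOfCoordinates`, chain rule
✓ `JacobianCriterion.pderiv_aeval`), giving, for a cubic form `F ∈ K[x₀,…,x₃]` and ANY matrix `B`:

* `singular_aeval_of_singular_mulVec`, `singular_aeval_vertex` — `F, ∇F` vanish at `Ba` ⟹ `F ∘ B, ∇(F ∘ B)` vanish at `a`;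
* ★ `aeval_mem_sq_of_singular_collinear` — columns `B_{·0}, B_{·1}` and their sum singular ⟹ `F ∘ B ∈ (x₂, x₃)²`;
* ★ `X_dvd_aeval_of_singular_coplanar` — columns `B_{·0}, B_{·1}, B_{·2}` and their sum singular ⟹ `x₃ ∣ F ∘ B`;
* ★ `aeval_eq_zero_of_singular_five` — all four columns and their sum singular ⟹ `F ∘ B = 0`;
* `not_X_dvd_of_prime`, `eq_zero_of_aeval_eq_zero` — the contradictions for a PRIME cubic form and `det B` a unit.

References: [Hartshorne1977, I Ex. 5.8]; Harris, *A First Course*, Lecture 1 (projective equivalence) via the cited tree file.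
-/

set_option linter.dupNamespace false -- mandated namespace `Summit.<Summit>.<Problem>` of this single-conjunct summit

noncomputable section

open MvPolynomial

namespace Summit.ResolutionOfSingularities.ResolutionOfSingularities.Cruxes.EquisingularLiftNat.Sections

namespace CubicNodes

variable {K : Type} [Field K]

/-! ## Transport along a linear change of coordinates `x ↦ Bx` -/

open Literature.AlgebraicGeometry.ProjectiveSpace in
/-- **Singular vectors travel along `x ↦ Bx`**: if `F` and `∇F` vanish at `Ba`, then `F ∘ B = aeval B.toMvPolynomial F` and its gradient vanish at
`a` (chain rule, ✓ `JacobianCriterion.pderiv_aeval`; no invertibility needed). [cite: Hartshorne1977, I Ex. 5.8] -/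
theorem singular_aeval_of_singular_mulVec {N : ℕ} (B : Matrix (Fin N) (Fin N) K) (F : MvPolynomial (Fin N) K) (a : Fin N → K)
    (h0 : eval (Matrix.mulVec B a) F = 0) (hd : ∀ j, eval (Matrix.mulVec B a) (pderiv j F) = 0) :
    eval a (aeval B.toMvPolynomial F) = 0 ∧ ∀ k, eval a (pderiv k (aeval B.toMvPolynomial F)) = 0 := by
  classical
  refine ⟨by rw [eval_aeval_toMvPolynomial]; exact h0, fun k => ?_⟩
  rw [Literature.Algebra.Polynomial.JacobianCriterion.pderiv_aeval, map_sum]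
  refine Finset.sum_eq_zero fun i _ => ?_
  rw [map_mul, eval_aeval_toMvPolynomial, hd i, zero_mul]

/-- `B e_c` is the `c`-th column of `B`. [folklore] -/
theorem mulVec_single_one_eq {N : ℕ} (B : Matrix (Fin N) (Fin N) K) (c : Fin N) :
    Matrix.mulVec B (Pi.single c 1 : Fin N → K) = fun l => B l c := by
  classical
  rw [Matrix.mulVec_single_one]; rfl

/-- `B (1,1,0,0)ᵀ` is the sum of the first two columns. [folklore] -/
theorem mulVec_oneOneZeroZero (B : Matrix (Fin 4) (Fin 4) K) :
    Matrix.mulVec B (![1, 1, 0, 0] : Fin 4 → K) = fun l => B l 0 + B l 1 := by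
  funext l
  simp [Matrix.mulVec, dotProduct, Fin.sum_univ_four]

/-- `B (1,1,1,0)ᵀ` is the sum of the first three columns. [folklore] -/
theorem mulVec_oneOneOneZero (B : Matrix (Fin 4) (Fin 4) K) :
    Matrix.mulVec B (![1, 1, 1, 0] : Fin 4 → K) = fun l => B l 0 + B l 1 + B l 2 := by
  funext l
  simp [Matrix.mulVec, dotProduct, Fin.sum_univ_four]

/-- `B (1,1,1,1)ᵀ` is the sum of the four columns. [folklore] -/
theorem mulVec_ones (B : Matrix (Fin 4) (Fin 4) K) :
    Matrix.mulVec B (fun _ => (1 : K)) = fun l => B l 0 + B l 1 + B l 2 + B l 3 := by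
  funext l
  simp [Matrix.mulVec, dotProduct, Fin.sum_univ_four]

/-- `F ∘ B` is singular at the vertex `e_c` when `F` is singular at the column `B_{·c}`. [cite: Hartshorne1977, I Ex. 5.8] -/
theorem singular_aeval_vertex {N : ℕ} (B : Matrix (Fin N) (Fin N) K) (F : MvPolynomial (Fin N) K) (c : Fin N)
    (h0 : eval (fun l => B l c) F = 0) (hd : ∀ j, eval (fun l => B l c) (pderiv j F) = 0) :
    eval (Pi.single c 1 : Fin N → K) (aeval B.toMvPolynomial F) = 0 ∧
      ∀ k, eval (Pi.single c 1 : Fin N → K) (pderiv k (aeval B.toMvPolynomial F)) = 0 :=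
  singular_aeval_of_singular_mulVec B F _ (by rw [mulVec_single_one_eq]; exact h0) (by rw [mulVec_single_one_eq]; exact hd)

open Literature.AlgebraicGeometry.ProjectiveSpace in
/-- ★ **Three collinear singular points, any coordinates**: if the columns `B_{·0}`, `B_{·1}` and their sum are singular vectors of the cubic form `F`,
then `F ∘ B ∈ (x₂, x₃)²`. [cite: Hartshorne1977, I Ex. 5.8] -/
theorem aeval_mem_sq_of_singular_collinear (B : Matrix (Fin 4) (Fin 4) K) {F : MvPolynomial (Fin 4) K} (hF : F.IsHomogeneous 3)
    (h0 : eval (fun l => B l 0) F = 0) (hd0 : ∀ j, eval (fun l => B l 0) (pderiv j F) = 0)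
    (h1 : eval (fun l => B l 1) F = 0) (hd1 : ∀ j, eval (fun l => B l 1) (pderiv j F) = 0)
    (h01 : eval (fun l => B l 0 + B l 1) F = 0) (hd01 : ∀ j, eval (fun l => B l 0 + B l 1) (pderiv j F) = 0) :
    aeval B.toMvPolynomial F ∈ (Ideal.span {(X 2 : MvPolynomial (Fin 4) K), X 3}) ^ 2 := by
  have hG : (aeval B.toMvPolynomial F).IsHomogeneous 3 := IsHomogeneous.aeval_toMvPolynomial B hF
  obtain ⟨e0, v0⟩ := singular_aeval_vertex B F 0 h0 hd0
  obtain ⟨e1, v1⟩ := singular_aeval_vertex B F 1 h1 hd1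
  obtain ⟨-, v01⟩ := singular_aeval_of_singular_mulVec B F (![1, 1, 0, 0] : Fin 4 → K)
    (by rw [mulVec_oneOneZeroZero]; exact h01) (by rw [mulVec_oneOneZeroZero]; exact hd01)
  exact mem_sq_of_singular_collinear hG (apply_le_one_of_singular_vertex hG 0 e0 v0) (apply_le_one_of_singular_vertex hG 1 e1 v1)
    (v01 2) (v01 3)

open Literature.AlgebraicGeometry.ProjectiveSpace in
/-- ★ **Four coplanar singular points, no three collinear, any coordinates**: if the columns `B_{·0}`, `B_{·1}`, `B_{·2}` and their sum are singular
vectors of the cubic form `F`, then `x₃ ∣ F ∘ B`. [cite: Hartshorne1977, I Ex. 5.8] -/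
theorem X_dvd_aeval_of_singular_coplanar (B : Matrix (Fin 4) (Fin 4) K) {F : MvPolynomial (Fin 4) K} (hF : F.IsHomogeneous 3)
    (h0 : eval (fun l => B l 0) F = 0) (hd0 : ∀ j, eval (fun l => B l 0) (pderiv j F) = 0)
    (h1 : eval (fun l => B l 1) F = 0) (hd1 : ∀ j, eval (fun l => B l 1) (pderiv j F) = 0)
    (h2 : eval (fun l => B l 2) F = 0) (hd2 : ∀ j, eval (fun l => B l 2) (pderiv j F) = 0)
    (h012 : eval (fun l => B l 0 + B l 1 + B l 2) F = 0) (hd012 : ∀ j, eval (fun l => B l 0 + B l 1 + B l 2) (pderiv j F) = 0) :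
    (X 3 : MvPolynomial (Fin 4) K) ∣ aeval B.toMvPolynomial F := by
  have hG : (aeval B.toMvPolynomial F).IsHomogeneous 3 := IsHomogeneous.aeval_toMvPolynomial B hF
  obtain ⟨e0, v0⟩ := singular_aeval_vertex B F 0 h0 hd0
  obtain ⟨e1, v1⟩ := singular_aeval_vertex B F 1 h1 hd1
  obtain ⟨e2, v2⟩ := singular_aeval_vertex B F 2 h2 hd2
  obtain ⟨-, v012⟩ := singular_aeval_of_singular_mulVec B F (![1, 1, 1, 0] : Fin 4 → K)
    (by rw [mulVec_oneOneOneZero]; exact h012) (by rw [mulVec_oneOneOneZero]; exact hd012)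
  exact X_dvd_of_singular_coplanar hG (apply_le_one_of_singular_vertex hG 0 e0 v0) (apply_le_one_of_singular_vertex hG 1 e1 v1)
    (apply_le_one_of_singular_vertex hG 2 e2 v2) (v012 0)

open Literature.AlgebraicGeometry.ProjectiveSpace in
/-- ★ **Five singular points, no four coplanar, any coordinates**: if all four columns of `B` and their sum are singular vectors of the cubic form
`F`, then `F ∘ B = 0`. [cite: Hartshorne1977, I Ex. 5.8] -/
theorem aeval_eq_zero_of_singular_five (B : Matrix (Fin 4) (Fin 4) K) {F : MvPolynomial (Fin 4) K} (hF : F.IsHomogeneous 3)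
    (hv : ∀ c : Fin 4, eval (fun l => B l c) F = 0 ∧ ∀ j, eval (fun l => B l c) (pderiv j F) = 0)
    (hone : eval (fun l => B l 0 + B l 1 + B l 2 + B l 3) F = 0) (hdone : ∀ j, eval (fun l => B l 0 + B l 1 + B l 2 + B l 3) (pderiv j F) = 0) :
    aeval B.toMvPolynomial F = 0 := by
  have hG : (aeval B.toMvPolynomial F).IsHomogeneous 3 := IsHomogeneous.aeval_toMvPolynomial B hF
  obtain ⟨eone, vone⟩ := singular_aeval_of_singular_mulVec B F (fun _ => (1 : K))
    (by rw [mulVec_ones]; exact hone) (by rw [mulVec_ones]; exact hdone)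
  refine eq_zero_of_singular_five hG (fun c => ?_) eone vone
  obtain ⟨ec, vc⟩ := singular_aeval_vertex B F c (hv c).1 (hv c).2
  exact apply_le_one_of_singular_vertex hG c ec vc

/-! ## Consequences for prime cubic forms -/

/-- A prime cubic form is not divisible by a variable. [folklore] -/
theorem not_X_dvd_of_prime {G : MvPolynomial (Fin 4) K} (hG : G.IsHomogeneous 3) (hprime : Prime G) (i : Fin 4) :
    ¬ (X i : MvPolynomial (Fin 4) K) ∣ G := by
  classical
  rintro ⟨H, hH⟩
  rcases hprime.irreducible.isUnit_or_isUnit hH with hu | hu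
  · have h := hu.map (eval (0 : Fin 4 → K))
    rw [eval_X, Pi.zero_apply] at h
    exact not_isUnit_zero h
  · obtain ⟨r, -, rfl⟩ := isUnit_iff_eq_C_of_isReduced.mp hu
    have h3 : G.totalDegree = 3 := hG.totalDegree hprime.ne_zero
    have h1 : G.totalDegree ≤ 1 := by
      rw [hH]
      refine (totalDegree_mul _ _).trans ?_
      rw [totalDegree_X, totalDegree_C]
    omega

open Literature.AlgebraicGeometry.ProjectiveSpace in
/-- `F ∘ B = 0` with `det B` a unit forces `F = 0`. [folklore] -/
theorem eq_zero_of_aeval_eq_zero {N : ℕ} {B : Matrix (Fin N) (Fin N) K} (hB : IsUnit B.det) {F : MvPolynomial (Fin N) K}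
    (h : aeval B.toMvPolynomial F = 0) : F = 0 := by
  classical
  apply aeval_toMvPolynomial_injective hB
  rw [h, map_zero]

end CubicNodes

end Summit.ResolutionOfSingularities.ResolutionOfSingularities.Cruxes.EquisingularLiftNat.Sections

end
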